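import Literature.IUT.LogVolume.DifferentDivisorDegree
import Literature.IUT.LogVolume.CompletionLocalFields
import Literature.IUT.LogVolume.LocalDegreeBridge
import Literature.IUT.LogVolume.RArithmeticDivisorsPullback
import Literature.NumberTheory.NumberFields.DifferentGaloisInvariant
import HarnessLib

/-!
# [IUTchIV] Thm. 1.10 Step (v): the different term `d(K_{v̲})` over a chosen section of places

Mochizuki, *Inter-universal Teichmüller theory IV*, RIMS manuscript (Apr. 2020), proof of Thm. 1.10,
Step (v), kurims pp. 27–28: with "`k_i` to be `K_{v_i}`" for `v_i ∈ V̲ ≅ V_mod = V(F_mod)` the upper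
bound carries "`d_I`" `= Σ_i d(K_{v̲_i})` (Prop. 1.1), and after weighted averaging over the places
`v ∈ V(F_mod)_{v_ℚ}` with weights `[(F_mod)_v : ℚ_{v_ℚ}]` the different term is read as
"`β_e := log(𝔡^K_v) …`", `log(𝔡^K_v) := deg_{V(K)_v}(𝔡^K_ADiv)` (p. 23), summing to `(j+1)·log(𝔡^K_{v_ℚ})`.
The identification of the CHOSEN-SECTION quantity `d(K_{v̲})·log p` with the fibre average
`log(𝔡^K_v)` uses that `K/F_mod` is Galois ([IUTchI] Rmk. 3.1.5): conjugate places have the same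
different exponent (`Literature.NumberTheory.NumberFields.multiplicity_absDifferent_eq_of_under_eq`).

Over the cell's GENUINE local fields (`PlaceSection.localFields`, abc-iut-S2: `K_{v̲} :=
RescaledCompletion K p (σ.lift v)`) and abc-iut-S1's local–global different bridge
(`differentOrd_rescaledCompletion`: `d(K_w) = ord_w(𝔇_{K/ℤ})/e(w|p)`), this file PROVES:

* `differentOrd_rescaledCompletion_eq_of_under_eq` — `K/F₀` Galois, `w, w'` over the same place of
  `F₀`: `d(K_w) = d(K_{w'})`; `differentOrd_rescaledCompletion_eq_localFields` — `= d(K_{v̲})`;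
* `sum_weight_mul_differentOrd_localFields_eq` — **`Σ_{v ∈ V(F₀)_p} Pr(v)·d(K_{v̲})·log p =
  (1/[K:ℚ])·Σ_{w ∈ V(K)_p} ord_w(𝔇_{K/ℤ})·log 𝐍(w)`** (`= log(𝔡^K_{v_ℚ})` of Def. 1.9 (ii));
* `sum_differentDivisor_mul_logNorm_le_degF` / `sum_weight_mul_differentOrd_localFields_le_ndeg` —
  summed over any finite set of primes this is `≤ deg(𝔡^K_ADiv)` resp. `≤ log(𝔡^K) = ndeg(𝔡^K)`.

Theorems only; classical Dedekind/local-field theory; nothing here bears on [IUTchIII] Cor. 3.12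
(the consumer is the `d_I`-part of `explicitDelta` in the Step (v) estimate, whatever the status of
Cor. 3.12).
-/

noncomputable section

open scoped NumberField

namespace Literature.IUT.LogVolume

open NumberField IsDedekindDomain Finset Literature.NumberTheory.NumberFields

variable (F₀ K : Type) [Field F₀] [NumberField F₀] [Field K] [NumberField K] [Algebra F₀ K]

/-! ## Conjugate places have the same local different exponent -/

omit [NumberField F₀] in
/-- If `p ∈ w` for a finite place `w`, i.e. `w ∈ V(K)_p`. [cite: NeukirchANT1999, Ch. I §8] -/
private theorem natCast_mem_of_mem_placesOver {p : ℕ} [Fact p.Prime] {w : HeightOneSpectrum (𝓞 K)}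
    (hw : w ∈ placesOver K p) : ((p : ℕ) : 𝓞 K) ∈ w.asIdeal := by
  have h := (mem_placesOver_iff w).mp hw
  have hmem : (p : ℤ) ∈ w.asIdeal.under ℤ := by
    rw [← h.over]; exact Ideal.mem_span_singleton_self _
  have := Ideal.mem_comap.mp hmem
  simpa using this

/-- **`K/F₀` Galois ⟹ `d(K_w) = d(K_{w'})` for places `w, w'` of `K` over the same place of `F₀`**
(`d(K_w) = ord_w(𝔇_{K/ℤ})/e(w|p)`, and both numerator and denominator are constant on the fibre).
[cite: Mochizuki2012, IUTchIV Thm. 1.10 proof Step (v) p. 28] -/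
theorem differentOrd_rescaledCompletion_eq_of_under_eq [IsGalois F₀ K] (p : ℕ) [Fact p.Prime]
    (w w' : HeightOneSpectrum (𝓞 K)) (hw : ((p : ℕ) : 𝓞 K) ∈ w.asIdeal)
    (hw' : ((p : ℕ) : 𝓞 K) ∈ w'.asIdeal) (h : w.asIdeal.under (𝓞 F₀) = w'.asIdeal.under (𝓞 F₀)) :
    differentOrd p (RescaledCompletion K p w hw) = differentOrd p (RescaledCompletion K p w' hw') := by
  rw [differentOrd_rescaledCompletion K p w hw, differentOrd_rescaledCompletion K p w' hw',
    multiplicity_absDifferent_eq_of_under_eq F₀ K w w' h, ramificationIdx_int_eq_of_under_eq F₀ K w w' h]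

/-- **In the fibre of `v ∈ V(F₀)_p`, every completion has the different exponent of the chosen
`K_{v̲}`**: `d(K_w) = d(K_{v̲})` for `w ∩ 𝓞_{F₀} = v` (`K/F₀` Galois; `K_{v̲} = (σ.localFields p).k v`).
[cite: Mochizuki2012, IUTchIV Thm. 1.10 proof Step (v) p. 28] -/
theorem differentOrd_rescaledCompletion_eq_localFields [IsGalois F₀ K] (σ : PlaceSection F₀ K)
    (p : ℕ) [Fact p.Prime] (v : placesOver F₀ p) (w : HeightOneSpectrum (𝓞 K))
    (hw : ((p : ℕ) : 𝓞 K) ∈ w.asIdeal) (h : w.asIdeal.under (𝓞 F₀) = v.1.asIdeal) :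
    differentOrd p (RescaledCompletion K p w hw) = differentOrd p ((σ.localFields p).k v) :=
  differentOrd_rescaledCompletion_eq_of_under_eq F₀ K p w (σ.lift v.1) hw (σ.natCast_mem_lift v)
    (h.trans (σ.under_asIdeal_lift v.1).symm)

/-! ## The weighted different sum over the section equals the `p`-part of `log(𝔡^K)` -/

omit [NumberField F₀] in
/-- The local term of `deg(𝔡^K_ADiv)` at `w ∈ V(K)_p`: `ord_w(𝔇_{K/ℤ})·log 𝐍(w) = n_w·d(K_w)·log p`
(abc-iut-S1 gen 2, restated at the places over `p`). [cite: Mochizuki2012, IUTchIV Def. 1.9 p. 21] -/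
theorem differentDivisor_mul_logNorm_eq_of_mem_placesOver (p : ℕ) [Fact p.Prime]
    {w : HeightOneSpectrum (𝓞 K)} (hw : w ∈ placesOver K p) :
    differentDivisor K (Sum.inr w) * logNorm K w =
      (localDegree K w : ℝ) * differentOrd p (RescaledCompletion K p w (natCast_mem_of_mem_placesOver K hw)) *
        Real.log p := by
  rw [differentDivisor_apply_mul_logNorm_eq K p w (natCast_mem_of_mem_placesOver K hw),
    localDeg_cast_eq_localDegree_cast]

omit [NumberField F₀] in
/-- The local terms are nonnegative. [cite: Mochizuki2012, IUTchIV Def. 1.9 p. 21] -/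
theorem differentDivisor_mul_logNorm_nonneg (w : HeightOneSpectrum (𝓞 K)) :
    0 ≤ differentDivisor K (Sum.inr w) * logNorm K w := by
  refine mul_nonneg (differentDivisor_isEffective K _) ?_
  unfold logNorm
  have h0 : Ideal.absNorm w.asIdeal ≠ 0 := Ideal.absNorm_eq_zero_iff.not.mpr w.ne_bot
  have h1 : (1 : ℝ) ≤ (Ideal.absNorm w.asIdeal : ℝ) := by exact_mod_cast Nat.one_le_iff_ne_zero.mpr h0
  exact Real.log_nonneg h1

/-- A place of `K` over `p` lies over a place of `F₀` over `p`. [cite: NeukirchANT1999, Ch. I §8] -/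
theorem finBelow_mem_placesOver {p : ℕ} [Fact p.Prime] {w : HeightOneSpectrum (𝓞 K)}
    (hw : w ∈ placesOver K p) : finBelow F₀ K w ∈ placesOver F₀ p := by
  have h := (mem_placesOver_iff w).mp hw
  rw [mem_placesOver_iff]
  haveI := h
  change (w.asIdeal.under (𝓞 F₀)).LiesOver (Ideal.span {(p : ℤ)})
  constructor
  rw [Ideal.under_under]
  exact h.over

open scoped Classical in
/-- The fibre of `v ∈ V(F₀)_p` inside `V(K)_p` is the set of places of `K` over `v` (they lie over `p`
automatically). [cite: NeukirchANT1999, Ch. I §8] -/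
theorem filter_finBelow_eq_placesAbove {p : ℕ} [Fact p.Prime] (v : HeightOneSpectrum (𝓞 F₀))
    (hv : v ∈ placesOver F₀ p) :
    ((placesOver K p).filter fun w => finBelow F₀ K w = v).map ⟨Sum.inr, Sum.inr_injective⟩ =
      placesAbove F₀ K (Sum.inr v) := by
  ext x
  simp only [Finset.mem_map, Finset.mem_filter, Function.Embedding.coeFn_mk]
  constructor
  · rintro ⟨w, ⟨-, hwv⟩, rfl⟩
    rw [mem_placesAbove_iff]
    simpa [Place.below] using hwv
  · intro hx
    rcases x with x | w
    · simp [placesAbove] at hx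
    · have hwv : finBelow F₀ K w = v := by
        have := (mem_placesAbove_iff (F := F₀) (K := K) (Sum.inr v) (Sum.inr w)).mp hx
        simpa [Place.below] using this
      refine ⟨w, ⟨?_, hwv⟩, rfl⟩
      -- `w` lies over `v`, `v` lies over `p`
      rw [mem_placesOver_iff]
      haveI : v.asIdeal.LiesOver (Ideal.span {(p : ℤ)}) := (mem_placesOver_iff v).mp hv
      haveI : w.asIdeal.LiesOver v.asIdeal := by rw [← hwv]; exact liesOver_finBelow F₀ K w
      exact Ideal.LiesOver.trans w.asIdeal v.asIdeal _

open scoped Classical in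
/-- **`Σ_{w | v} n_w = [K:F₀]·n_v`** over the fibre of `v ∈ V(F₀)_p` in `V(K)_p` (the tree's
`sum_placeDegree_placesAbove`, re-indexed). [cite: Mochizuki2012, IUTchIV Def. 1.9 (ii) p. 22] -/
theorem sum_filter_finBelow_localDegree {p : ℕ} [Fact p.Prime] (v : HeightOneSpectrum (𝓞 F₀))
    (hv : v ∈ placesOver F₀ p) :
    ∑ w ∈ (placesOver K p).filter (fun w => finBelow F₀ K w = v), (localDegree K w : ℝ) =
      Module.finrank F₀ K * localDegree F₀ v := by
  have h := sum_placeDegree_placesAbove (F := F₀) (K := K) (Sum.inr v)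
  rw [← filter_finBelow_eq_placesAbove F₀ K v hv, Finset.sum_map] at h
  simpa [placeDegree] using h

/-- **The different term of [IUTchIV] Thm. 1.10 Step (v) over the chosen section IS the `p`-part of
`log(𝔡^K)`**: for `K/F₀` Galois and a section `v ↦ v̲` of the places,
`Σ_{v ∈ V(F₀)_p} Pr(v)·d(K_{v̲})·log p = (1/[K:ℚ])·Σ_{w ∈ V(K)_p} ord_w(𝔇_{K/ℤ})·log 𝐍(w)`
(`Pr(v) = n_v/[F₀:ℚ]`; the right side is `deg_{V(K)_{v_ℚ}}(𝔡^K_ADiv) = log(𝔡^K_{v_ℚ})` of Def. 1.9 (ii),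
p. 23). [cite: Mochizuki2012, IUTchIV Thm. 1.10 proof Step (v) p. 28] -/
theorem sum_weight_mul_differentOrd_localFields_eq [IsGalois F₀ K] (σ : PlaceSection F₀ K)
    (p : ℕ) [Fact p.Prime] :
    ∑ v ∈ (placesOver F₀ p).attach, weight F₀ v.1 * differentOrd p ((σ.localFields p).k v) * Real.log p =
      (∑ w ∈ placesOver K p, differentDivisor K (Sum.inr w) * logNorm K w) / Module.finrank ℚ K := by
  classical
  have hK : (0 : ℝ) < Module.finrank ℚ K := by exact_mod_cast Module.finrank_pos
  have hF : (0 : ℝ) < Module.finrank ℚ F₀ := by exact_mod_cast Module.finrank_pos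
  have hmaps : ∀ w ∈ placesOver K p, finBelow F₀ K w ∈ placesOver F₀ p :=
    fun w hw => finBelow_mem_placesOver F₀ K hw
  -- each fibre contributes `[K:F₀]·n_v·d(K_{v̲})·log p`
  have hfib : ∀ (v : HeightOneSpectrum (𝓞 F₀)) (hv : v ∈ placesOver F₀ p),
      ∑ w ∈ (placesOver K p).filter (fun w => finBelow F₀ K w = v),
          differentDivisor K (Sum.inr w) * logNorm K w =
        Module.finrank F₀ K * localDegree F₀ v *
          differentOrd p ((σ.localFields p).k ⟨v, hv⟩) * Real.log p := by
    intro v hv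
    calc ∑ w ∈ (placesOver K p).filter (fun w => finBelow F₀ K w = v),
          differentDivisor K (Sum.inr w) * logNorm K w
        = ∑ w ∈ (placesOver K p).filter (fun w => finBelow F₀ K w = v),
            (localDegree K w : ℝ) * (differentOrd p ((σ.localFields p).k ⟨v, hv⟩) * Real.log p) := by
          refine Finset.sum_congr rfl fun w hw => ?_
          obtain ⟨hwp, hwv⟩ := Finset.mem_filter.mp hw
          rw [differentDivisor_mul_logNorm_eq_of_mem_placesOver K p hwp,
            differentOrd_rescaledCompletion_eq_localFields F₀ K σ p ⟨v, hv⟩ w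
              (natCast_mem_of_mem_placesOver K hwp) (congrArg HeightOneSpectrum.asIdeal hwv)]
          ring
      _ = Module.finrank F₀ K * localDegree F₀ v *
            differentOrd p ((σ.localFields p).k ⟨v, hv⟩) * Real.log p := by
          rw [← Finset.sum_mul, sum_filter_finBelow_localDegree F₀ K v hv]
          ring
  rw [eq_div_iff hK.ne', finrank_rat_eq_mul (F := F₀) (K := K)]
  symm
  calc ∑ w ∈ placesOver K p, differentDivisor K (Sum.inr w) * logNorm K w
      = ∑ v ∈ placesOver F₀ p, ∑ w ∈ (placesOver K p).filter (fun w => finBelow F₀ K w = v),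
          differentDivisor K (Sum.inr w) * logNorm K w :=
        (Finset.sum_fiberwise_of_maps_to hmaps _).symm
    _ = ∑ v ∈ placesOver F₀ p, (if hv : v ∈ placesOver F₀ p then
          (Module.finrank F₀ K : ℝ) * localDegree F₀ v *
            differentOrd p ((σ.localFields p).k ⟨v, hv⟩) * Real.log p else 0) :=
        Finset.sum_congr rfl fun v hv => by rw [dif_pos hv]; exact hfib v hv
    _ = ∑ v ∈ (placesOver F₀ p).attach, (Module.finrank F₀ K : ℝ) * localDegree F₀ v.1 *
            differentOrd p ((σ.localFields p).k v) * Real.log p := by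
        rw [← Finset.sum_attach]
        exact Finset.sum_congr rfl fun v _ => by rw [dif_pos v.2]
    _ = (∑ v ∈ (placesOver F₀ p).attach,
          weight F₀ v.1 * differentOrd p ((σ.localFields p).k v) * Real.log p) *
            (Module.finrank F₀ K * Module.finrank ℚ F₀) := by
        rw [Finset.sum_mul]
        refine Finset.sum_congr rfl fun v _ => ?_
        unfold weight
        field_simp

/-- Summing the `p`-parts over any finite set of PRIMES stays below the whole degree:
`Σ_{p ∈ T} Σ_{w ∈ V(K)_p} ord_w(𝔇_{K/ℤ})·log 𝐍(w) ≤ deg(𝔡^K_ADiv)` (all local terms are `≥ 0` and the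
fibres over distinct primes are disjoint). [cite: Mochizuki2012, IUTchIV Def. 1.9 p. 21] -/
theorem sum_differentDivisor_mul_logNorm_le_degF (T : Finset ℕ) (hT : ∀ p ∈ T, p.Prime) :
    ∑ p ∈ T, ∑ w ∈ placesOver K p, differentDivisor K (Sum.inr w) * logNorm K w ≤
      degF K (differentDivisor K) := by
  classical
  -- the union of the fibres over `T`
  have hdisj : (T : Set ℕ).PairwiseDisjoint (placesOver K) := by
    intro p hp q hq hpq
    haveI : Fact p.Prime := ⟨hT p hp⟩
    haveI : Fact q.Prime := ⟨hT q hq⟩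
    refine Finset.disjoint_left.mpr fun w hwp hwq => hpq ?_
    rw [mem_placesOver_iff_residueChar] at hwp hwq
    exact hwp.symm.trans hwq
  rw [← Finset.sum_biUnion hdisj]
  set S := T.biUnion (placesOver K) with hS
  -- `degF` as a sum over `S ∪ support`, all terms nonnegative
  set U := S ∪ (finite_setOf_multiplicity_ne_zero K (differentIdeal_ne_bot' K)).toFinset with hU
  have hdeg := degF_differentDivisor_eq_sum_local_of_subset K U (fun v hv => by
    rw [hU, Finset.mem_union, Set.Finite.mem_toFinset]
    exact Or.inr hv)
  rw [hdeg]
  calc ∑ w ∈ S, differentDivisor K (Sum.inr w) * logNorm K w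
      = ∑ w ∈ S, (haveI : Fact (residueChar K w).Prime := ⟨residueChar_prime K w⟩
          (localDeg K w : ℝ) *
            differentOrd (residueChar K w) (RescaledCompletion K (residueChar K w) w (natCast_residueChar_mem K w)) *
          Real.log (residueChar K w)) := by
        refine Finset.sum_congr rfl fun w _ => ?_
        haveI : Fact (residueChar K w).Prime := ⟨residueChar_prime K w⟩
        exact differentDivisor_apply_mul_logNorm_eq K (residueChar K w) w (natCast_residueChar_mem K w)
    _ ≤ _ := by
        refine Finset.sum_le_sum_of_subset_of_nonneg Finset.subset_union_left fun w _ _ => ?_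
        haveI : Fact (residueChar K w).Prime := ⟨residueChar_prime K w⟩
        rw [← differentDivisor_apply_mul_logNorm_eq K (residueChar K w) w (natCast_residueChar_mem K w)]
        exact differentDivisor_mul_logNorm_nonneg K w

/-- **Step (v)'s different term, summed over any finite set of primes, is at most `log(𝔡^K)`**:
`Σ_{p ∈ T} Σ_{v ∈ V(F₀)_p} Pr(v)·d(K_{v̲})·log p ≤ ndeg(𝔡^K_ADiv) = log(𝔡^K)` (`K/F₀` Galois; the
`dite` supplies the `Fact p.Prime` instance exactly as in the cell's `explicitDelta`).
[cite: Mochizuki2012, IUTchIV Thm. 1.10 proof Step (v) p. 28] -/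
theorem sum_weight_mul_differentOrd_localFields_le_ndeg [IsGalois F₀ K] (σ : PlaceSection F₀ K)
    (T : Finset ℕ) (hT : ∀ p ∈ T, p.Prime) :
    ∑ p ∈ T, (if hp : p.Prime then
        haveI : Fact p.Prime := ⟨hp⟩
        ∑ v ∈ (placesOver F₀ p).attach, weight F₀ v.1 * differentOrd p ((σ.localFields p).k v) * Real.log p
      else 0) ≤ ndeg K (differentDivisor K) := by
  have hK : (0 : ℝ) < Module.finrank ℚ K := by exact_mod_cast Module.finrank_pos
  rw [ndeg_apply, le_div_iff₀ hK, Finset.sum_mul]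
  refine le_trans (le_of_eq ?_) (sum_differentDivisor_mul_logNorm_le_degF K T hT)
  refine Finset.sum_congr rfl fun p hp => ?_
  rw [dif_pos (hT p hp)]
  haveI : Fact p.Prime := ⟨hT p hp⟩
  rw [sum_weight_mul_differentOrd_localFields_eq F₀ K σ p, div_mul_cancel₀ _ hK.ne']

/-- The same bound in the EXACT currency of the cell's Step (v) constant (abc-iut-c312-d1's
`hullEstimateOf_ofInput_explicit`: sum over `Finset.univ` of the subtype `placesOver F₀ p`, weights
`n_v/[F₀:ℚ]` written as a quotient, local fields through `localFieldFamily p hp`):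
`Σ_{p ∈ T} (Σ_{v | p} n_v·d(K_{v̲}))/[F₀:ℚ]·log p ≤ log(𝔡^K)` for `K/F₀` Galois and any finite set `T`
of primes. [cite: Mochizuki2012, IUTchIV Thm. 1.10 proof Step (v) p. 28] -/
theorem sum_dite_localDegree_mul_differentOrd_le_ndeg [IsGalois F₀ K] (σ : PlaceSection F₀ K)
    (T : Finset ℕ) (hT : ∀ p ∈ T, p.Prime) :
    ∑ p ∈ T, (if hp : p.Prime then
        haveI : Fact p.Prime := ⟨hp⟩
        (∑ v : placesOver F₀ p, (localDegree F₀ v.1 : ℝ) *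
            differentOrd p ((σ.localFieldFamily p hp).k v)) / Module.finrank ℚ F₀ * Real.log p
      else 0) ≤ ndeg K (differentDivisor K) := by
  refine le_trans (le_of_eq ?_) (sum_weight_mul_differentOrd_localFields_le_ndeg F₀ K σ T hT)
  refine Finset.sum_congr rfl fun p hp => ?_
  rw [dif_pos (hT p hp), dif_pos (hT p hp)]
  haveI : Fact p.Prime := ⟨hT p hp⟩
  rw [Finset.univ_eq_attach, Finset.sum_div, Finset.sum_mul]
  refine Finset.sum_congr rfl fun v _ => ?_
  rw [PlaceSection.localFieldFamily_apply]
  unfold weight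
  ring

/-- Per prime, in the same currency: `(Σ_{v | p} n_v·d(K_{v̲}))/[F₀:ℚ]·log p =
(1/[K:ℚ])·Σ_{w ∈ V(K)_p} ord_w(𝔇_{K/ℤ})·log 𝐍(w) = log(𝔡^K_{v_ℚ})` (`K/F₀` Galois).
[cite: Mochizuki2012, IUTchIV Thm. 1.10 proof Step (v) p. 28] -/
theorem sum_localDegree_mul_differentOrd_div_eq [IsGalois F₀ K] (σ : PlaceSection F₀ K)
    (p : ℕ) [hp : Fact p.Prime] :
    (∑ v : placesOver F₀ p, (localDegree F₀ v.1 : ℝ) *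
        differentOrd p ((σ.localFieldFamily p hp.out).k v)) / Module.finrank ℚ F₀ * Real.log p =
      (∑ w ∈ placesOver K p, differentDivisor K (Sum.inr w) * logNorm K w) / Module.finrank ℚ K := by
  rw [← sum_weight_mul_differentOrd_localFields_eq F₀ K σ p, Finset.univ_eq_attach, Finset.sum_div,
    Finset.sum_mul]
  refine Finset.sum_congr rfl fun v _ => ?_
  rw [PlaceSection.localFieldFamily_apply]
  unfold weight
  ring

end Literature.IUT.LogVolume


end
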